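import Summits.Ventures.PercRepro.Night2FatXDichotomy

/-!
# night-2: a distance-1 load above `Q ∪ {x}` sits on a basis line

With the fat split, a loaded target `T = Q ∪ {x} ∪ Y` of a basis pair carries a line `R ⊆ P₀ ∪ Y`
(`P₀ = Q ∖ K ∖ {w₀}`, four independent points) with `|R| ≥ |Y| + 1` (`loaded_fat_target_dichotomy`), and at distance one
`|R| = |Y| + 2`.  Since `|R ∩ Q| ≤ 2`, the line is then exactly `Y ∪ {a, b}` for two basis points `a ≠ b`:
**`sdiff_subset_line_of_dist_one_fat`** (`Y ⊆ R` and `|R ∩ Q| = 2`), so **the points of `Y` lie on a basis line**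
(`exists_basis_line_of_dist_one_fat`: `rk (Y ∪ {a, b}) = 2`).  At level `2` every load is at distance one (a distance-2
target has eight points off `K`), so a loaded `Q ∪ {x, y}` has `y` on a basis line and `rk (G ∖ T) ≥ 3`
(`exists_basis_line_of_loaded_level_two_fat`).  Paper `proofs/NIGHT-2-g33.md` §4.1.
-/

namespace PercRepro.Shadow

open PercRepro.ThmH PercRepro.PerFlat

variable {α : Type*} [DecidableEq α] {M : Matroid α} [M.Finite] {G : Finset α}

/-- **A distance-1 line contains `Y = T ∖ Q ∖ {x}` and meets `Q` in exactly two points.** -/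
theorem sdiff_subset_line_of_dist_one_fat (hG : G ∈ flatsQ M (5 + 1)) (hd : (gr M \ G).card = 2)
    (hk : kColoops M G = 1) {B : Finset α} (hB : B ∈ thinMembers M 5 G) (hnP : ¬ bigP M G B) {z : α}
    (hz : z ∈ G \ clF M B) {T : Finset α} (hT : T ∈ tgtSets M 5 G B z) {w₀ x : α} (hxT : x ∈ T)
    (hxQ : x ∉ insert z B) {R : Finset α} (hR : R ⊆ (T \ coloops M G) \ {w₀, x}) (hR2 : rkN M R = 2)
    (hRc : R.card + 4 = (T \ coloops M G).card) :
    (T \ insert z B).erase x ⊆ R ∧ (R ∩ insert z B).card = 2 := by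
  have hlev := card_sdiff_coloops_eq_level_add_five hG hd hk hB hnP hz hT
  have hxTQ : x ∈ T \ insert z B := Finset.mem_sdiff.2 ⟨hxT, hxQ⟩
  have hY : ((T \ insert z B).erase x).card + 1 = (T \ insert z B).card := by
    rw [Finset.card_erase_of_mem hxTQ]
    have : 0 < (T \ insert z B).card := Finset.card_pos.2 ⟨x, hxTQ⟩
    omega
  have hxR : x ∉ R := fun h' => (Finset.mem_sdiff.1 (hR h')).2
    (Finset.mem_insert_of_mem (Finset.mem_singleton_self _))
  have hRT : R ⊆ T \ coloops M G := fun r hr => (Finset.mem_sdiff.1 (hR hr)).1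
  -- `R ∖ Q ⊆ Y`
  have hsub : R \ insert z B ⊆ (T \ insert z B).erase x := by
    intro r hr
    rw [Finset.mem_sdiff] at hr
    exact Finset.mem_erase.2 ⟨fun h' => hxR (h' ▸ hr.1), Finset.mem_sdiff.2 ⟨(Finset.mem_sdiff.1 (hRT hr.1)).1, hr.2⟩⟩
  -- `|R ∩ Q| ≤ 2`: `R ∩ Q` is an independent subset of `Q ∖ K` of rank `≤ 2`
  have hQ5 := card_insert_sdiff_eq_five hG hd hk hB hnP hz
  have hrk5 := rkN_insert_sdiff_coloops_eq_five_of_thin hG hd hk hB hz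
  have hind : M.Indep ((insert z B \ coloops M G : Finset α) : Set α) :=
    indep_of_rkN_eq_card (by rw [hrk5, hQ5])
  have hsubQ : R ∩ insert z B ⊆ insert z B \ coloops M G := by
    intro e he
    rw [Finset.mem_inter] at he
    exact Finset.mem_sdiff.2 ⟨he.2, (Finset.mem_sdiff.1 (hRT he.1)).2⟩
  have hind' : M.Indep ((R ∩ insert z B : Finset α) : Set α) := hind.subset (by exact_mod_cast hsubQ)
  have h1 : rkN M (R ∩ insert z B) = (R ∩ insert z B).card := rkN_eq_card_of_indep hind'
  have h2 : rkN M (R ∩ insert z B) ≤ rkN M R := rkN_mono Finset.inter_subset_left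
  have h3 := Finset.card_sdiff_add_card_inter R (insert z B)
  have h4 := Finset.card_le_card hsub
  have heq : R \ insert z B = (T \ insert z B).erase x := Finset.eq_of_subset_of_card_le hsub (by omega)
  refine ⟨?_, by omega⟩
  rw [← heq]
  exact Finset.sdiff_subset

/-- **A distance-1 load above `Q ∪ {x}` has `Y = T ∖ Q ∖ {x}` on a basis line**: two basis points `a ≠ b` off `w₀`
with `rk (Y ∪ {a, b}) = 2`. -/
theorem exists_basis_line_of_dist_one_fat (hG : G ∈ flatsQ M (5 + 1)) (hd : (gr M \ G).card = 2)
    (hk : kColoops M G = 1) (hs : ∀ e ∈ gr M, ∀ f ∈ gr M, e ≠ f → rkN M {e, f} = 2) {B : Finset α}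
    (hB : B ∈ thinMembers M 5 G) (hnP : ¬ bigP M G B) {z : α} (hz : z ∈ G \ clF M B) {T : Finset α}
    (hT : T ∈ tgtSets M 5 G B z) {w₀ x : α} (hxT : x ∈ T) (hxQ : x ∉ insert z B) {R : Finset α}
    (hR : R ⊆ (T \ coloops M G) \ {w₀, x}) (hR2 : rkN M R = 2) (hRc : R.card + 4 = (T \ coloops M G).card) :
    ∃ a ∈ (insert z B \ coloops M G).erase w₀, ∃ b ∈ (insert z B \ coloops M G).erase w₀, a ≠ b ∧
      rkN M (insert a (insert b ((T \ insert z B).erase x))) = 2 := by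
  obtain ⟨hYR, hcard⟩ := sdiff_subset_line_of_dist_one_fat hG hd hk hB hnP hz hT hxT hxQ hR hR2 hRc
  obtain ⟨a, b, hab, hpair⟩ := Finset.card_eq_two.1 hcard
  have haRQ : a ∈ R ∩ insert z B := by
    rw [hpair]
    exact Finset.mem_insert_self _ _
  have hbRQ : b ∈ R ∩ insert z B := by
    rw [hpair]
    exact Finset.mem_insert_of_mem (Finset.mem_singleton_self _)
  have hmem : ∀ e ∈ R ∩ insert z B, e ∈ (insert z B \ coloops M G).erase w₀ := by
    intro e he
    rw [Finset.mem_inter] at he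
    have he' := Finset.mem_sdiff.1 (hR he.1)
    refine Finset.mem_erase.2 ⟨fun h' => he'.2 (h' ▸ Finset.mem_insert_self _ _), ?_⟩
    exact Finset.mem_sdiff.2 ⟨he.2, (Finset.mem_sdiff.1 he'.1).2⟩
  refine ⟨a, hmem a haRQ, b, hmem b hbRQ, hab, ?_⟩
  have hsub : insert a (insert b ((T \ insert z B).erase x)) ⊆ R := by
    intro e he
    rw [Finset.mem_insert, Finset.mem_insert] at he
    rcases he with rfl | rfl | he
    · exact (Finset.mem_inter.1 haRQ).1
    · exact (Finset.mem_inter.1 hbRQ).1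
    · exact hYR he
  have hGg : G ⊆ gr M := (mem_flatsQ.1 hG).1
  have hTG : T ⊆ G := subset_G_of_mem_shadowAt (mem_tgtSets.1 hT).1
  have hRgr : R ⊆ gr M := fun r hr => hGg (hTG (Finset.mem_sdiff.1 ((Finset.mem_sdiff.1 (hR hr)).1)).1)
  have hle : rkN M (insert a (insert b ((T \ insert z B).erase x))) ≤ 2 := by
    rw [← hR2]
    exact rkN_mono hsub
  have hge : 2 ≤ rkN M (insert a (insert b ((T \ insert z B).erase x))) :=
    rkN_pair_eq_two hs (hsub.trans hRgr) (Finset.mem_insert_self _ _)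
      (Finset.mem_insert_of_mem (Finset.mem_insert_self _ _)) hab
  omega

/-- **A loaded level-2 target `Q ∪ {x, y}` has `y` on a basis line and a complement of rank `≥ 3`**: at level `2`
the load is at distance one. -/
theorem exists_basis_line_of_loaded_level_two_fat (hG : G ∈ flatsQ M (5 + 1)) (hd : (gr M \ G).card = 2)
    (hk : kColoops M G = 1) (hs : ∀ e ∈ gr M, ∀ f ∈ gr M, e ≠ f → rkN M {e, f} = 2)
    (hl : ∀ e ∈ gr M, M.Indep {e}) (hfat : (fatClosures M 5 G 2).card ≤ 1) {B₀ : Finset α}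
    (hB₀ : B₀ ∈ thinMembers M 5 G) {w₀ x : α} (hD : G \ clF M B₀ = {w₀, x}) {B : Finset α}
    (hB : B ∈ thinMembers M 5 G) (hnP : ¬ bigP M G B) {z : α} (hz : z ∈ G \ clF M B) {T : Finset α}
    (hT : T ∈ tgtSets M 5 G B z) (hxT : x ∈ T) (hxQ : x ∉ insert z B) (h2 : (T \ insert z B).card = 2)
    (hload : dload M 5 G (bigP M G) (dshGT2 M 5 G) T ≠ 0) :
    (∃ a ∈ (insert z B \ coloops M G).erase w₀, ∃ b ∈ (insert z B \ coloops M G).erase w₀, a ≠ b ∧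
      rkN M (insert a (insert b ((T \ insert z B).erase x))) = 2) ∧ 3 ≤ rkN M (G \ T) := by
  have hTG : T ⊆ G := subset_G_of_mem_shadowAt (mem_tgtSets.1 hT).1
  have hlev := card_sdiff_coloops_eq_level_add_five hG hd hk hB hnP hz hT
  obtain ⟨R, hR, hR2, hR3, hcase⟩ := loaded_fat_target_dichotomy hG hd hk hs hl hfat hB₀ hD hTG hload
  rcases hcase with ⟨hRc, hrk⟩ | ⟨hRc, -⟩
  · exact ⟨exists_basis_line_of_dist_one_fat hG hd hk hs hB hnP hz hT hxT hxQ hR hR2 hRc, hrk⟩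
  · exfalso
    omega

end PercRepro.Shadow
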